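import Mathlib
import HarnessLib
import Summits.NavierStokesRegularity.NavierStokesRegularity.Theorems.UnthreadedDoorNetFluxOneSidedLawCalculus
import Summits.NavierStokesRegularity.NavierStokesRegularity.Theorems.UnthreadedDoorNetFluxExtremalHeadContinuity

/-!
# Route `UnthreadedDoor`, crux `PoloidalLiouville` (stmt-NavierStokesRegularity-1222), WALL W1 — crux idea «null-time» (ns-idea-14 g5,
# `Cruxes/PoloidalLiouville/NullTimeSketch.lean` v1.1): stub AE-3b `NetFluxRhoLipschitz`, PROVED (by name)

`NetFlux.netFluxRhoLipschitz : <body of NullTime.NetFluxRhoLipschitz VERBATIM>`: for `T` smooth on `]t₀,0[ × (ℝ³ ∖ {x₀})`, the net flux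
`r ↦ netFlux(T t, r) = r · osc_{S_r(x₀)} T(t)` is Lipschitz on `[a,R]` (`0 < a < R`) with ONE constant for all `t ∈ [t₁,t₂] ⊂ ]t₀,0[`.

PROOF.  On the compact shell `K = [t₁,t₂] × {a ≤ ‖x − x₀‖ ≤ R}` (inside the smoothness region) `‖∇ₓT‖ ≤ G` and `|T| ≤ M`.  Along rays,
`|T(t, x₀ + rξ) − T(t, x₀ + r'ξ)| ≤ G|r − r'|` (mean value on `[a,R]`), so the spherical max and min move by at most `G|r − r'|`
(`abs_sphSup_sub_le_of_forall`, `abs_sphInf_sub_le_of_forall`, p-ExtremalHeadContinuity) and `|osc(r) − osc(r')| ≤ 2G|r − r'|`; with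
`0 ≤ osc ≤ 2M` and `netFlux r − netFlux r' = r(osc r − osc r') + (r − r')osc r'` the constant `L = 2RG + 2M` works.
In the sketch: `theorem stub_netFluxRhoLipschitz : NetFluxRhoLipschitz := Theorems.PoloidalLiouville.NetFlux.netFluxRhoLipschitz`.

HONEST LABEL: one S stub of the a.e.-time chain (crux idea «null-time» v1.1, critic V19 PASS-WITH-PRICE); `PoloidalLiouville` (1222), C⁻, W1 and
the summit stay OPEN; NO Navier–Stokes regularity statement is proved.  `--supports stmt-NavierStokesRegularity-1222 --as helper`.  [folklore]
-/

noncomputable section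

-- the summit and its single sub-problem share the name (CONVENTIONS §1)
set_option linter.dupNamespace false

open Set Function Filter Topology InnerProductSpace MeasureTheory
open scoped RealInnerProductSpace NNReal

namespace Summit.NavierStokesRegularity.NavierStokesRegularity.Theorems.PoloidalLiouville.NetFlux

open Literature.Analysis Literature.Analysis.FluidPDE

/-- **AE-3b `NetFluxRhoLipschitz`, proved**: `r ↦ netFlux(T t, r)` is Lipschitz on `[a,R]`, `0 < a < R`, uniformly for `t` in a compact
sub-window, when `T` is smooth on the window off the centre.  Statement = the sketch's `NullTime.NetFluxRhoLipschitz` verbatim.  No NS statement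
is involved. [folklore] -/
theorem netFluxRhoLipschitz :
    ∀ (x₀ : E3) (T : ℝ → E3 → ℝ) (t₀ : ℝ),
    ContDiffOn ℝ (⊤ : ℕ∞) (uncurry T) (Ioo t₀ 0 ×ˢ ({x₀}ᶜ : Set E3)) →
    ∀ t₁ t₂ a R : ℝ, t₀ < t₁ → t₁ < t₂ → t₂ < 0 → 0 < a → a < R →
      ∃ L : NNReal, ∀ t ∈ Icc t₁ t₂, LipschitzOnWith L (fun r => netFlux (T t) x₀ r) (Icc a R) := by
  intro x₀ T t₀ hT t₁ t₂ a R h01 _ h20 ha haR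
  set W : Set (ℝ × E3) := Ioo t₀ 0 ×ˢ ({x₀}ᶜ : Set E3) with hWdef
  have hW : IsOpen W := isOpen_Ioo.prod isOpen_compl_singleton
  have hIcc : Icc t₁ t₂ ⊆ Ioo t₀ 0 := fun s hs => ⟨h01.trans_le hs.1, lt_of_le_of_lt hs.2 h20⟩
  have hR0 : 0 ≤ R := (ha.trans haR).le
  -- the compact shell inside the smoothness region
  set K : Set (ℝ × E3) := Icc t₁ t₂ ×ˢ ((fun x : E3 => ‖x - x₀‖) ⁻¹' Icc a R) with hKdef
  have hshell : IsCompact ((fun x : E3 => ‖x - x₀‖) ⁻¹' Icc a R) :=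
    (isCompact_closedBall x₀ R).of_isClosed_subset (isClosed_Icc.preimage (continuous_id.sub continuous_const).norm)
      fun x hx => mem_closedBall_iff_norm.2 hx.2
  have hKc : IsCompact K := isCompact_Icc.prod hshell
  have hKW : K ⊆ W := by
    rintro ⟨s, x⟩ ⟨hs, hx⟩
    refine ⟨hIcc hs, fun h => ?_⟩
    have hx0 : x = x₀ := h
    have : a ≤ ‖x - x₀‖ := hx.1
    rw [hx0, sub_self, norm_zero] at this
    exact absurd this (not_le.2 ha)
  -- bounds of `‖∇ₓT‖` and `|T|` on the shell
  obtain ⟨G₀, hG₀⟩ := hKc.exists_bound_of_continuousOn ((contDiffOn_fderiv_xslice hW hT).2.continuousOn.mono hKW)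
  obtain ⟨M₀, hM₀⟩ := hKc.exists_bound_of_continuousOn (hT.continuousOn.mono hKW)
  set G : ℝ := max G₀ 0 with hGdef
  set M : ℝ := max M₀ 0 with hMdef
  have hG0 : 0 ≤ G := le_max_right _ _
  have hM0 : 0 ≤ M := le_max_right _ _
  have hG : ∀ t ∈ Icc t₁ t₂, ∀ x : E3, ‖x - x₀‖ ∈ Icc a R → ‖fderiv ℝ (T t) x‖ ≤ G := fun t ht x hx =>
    (hG₀ (t, x) ⟨ht, hx⟩).trans (le_max_left _ _)
  have hM : ∀ t ∈ Icc t₁ t₂, ∀ x : E3, ‖x - x₀‖ ∈ Icc a R → |T t x| ≤ M := fun t ht x hx => by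
    have h := (hM₀ (t, x) ⟨ht, hx⟩).trans (le_max_left M₀ 0)
    rwa [Real.norm_eq_abs] at h
  -- slices
  have hTt : ∀ t ∈ Icc t₁ t₂, ContDiffOn ℝ (⊤ : ℕ∞) (T t) ({x₀}ᶜ) := fun t ht => contDiffOn_slice_compl hT (hIcc ht)
  have hdT : ∀ t ∈ Icc t₁ t₂, ∀ x : E3, x ≠ x₀ → DifferentiableAt ℝ (T t) x := fun t ht x hx =>
    ((hTt t ht).differentiableOn (by simp) x hx).differentiableAt (isOpen_compl_singleton.mem_nhds hx)
  have hcs : ∀ t ∈ Icc t₁ t₂, ∀ {r : ℝ}, 0 < r → ContinuousOn (T t) (Metric.sphere x₀ r) := fun t ht r hr =>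
    continuousOn_sphere_of_continuousOn_compl (hTt t ht).continuousOn hr
  -- mean value along rays
  have hray : ∀ t ∈ Icc t₁ t₂, ∀ ξ : E3, ‖ξ‖ = 1 → ∀ r ∈ Icc a R, ∀ r' ∈ Icc a R,
      |T t (x₀ + r • ξ) - T t (x₀ + r' • ξ)| ≤ G * |r - r'| := by
    intro t ht ξ hξ r hr r' hr'
    have hnorm : ∀ ρ ∈ Icc a R, ‖x₀ + ρ • ξ - x₀‖ = ρ := fun ρ hρ => by
      rw [add_sub_cancel_left, norm_smul, hξ, mul_one, Real.norm_eq_abs, abs_of_pos (ha.trans_le hρ.1)]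
    have hder : ∀ ρ ∈ Icc a R,
        HasDerivWithinAt (fun ρ : ℝ => T t (x₀ + ρ • ξ)) (fderiv ℝ (T t) (x₀ + ρ • ξ) ξ) (Icc a R) ρ := by
      intro ρ hρ
      have hne : x₀ + ρ • ξ ≠ x₀ := by
        intro h
        have h' := hnorm ρ hρ
        rw [h, sub_self, norm_zero] at h'
        linarith [ha.trans_le hρ.1]
      have h1 : HasDerivAt (fun ρ : ℝ => x₀ + ρ • ξ) ξ ρ := by
        simpa using ((hasDerivAt_id ρ).smul_const ξ).const_add x₀
      exact ((hdT t ht _ hne).hasFDerivAt.comp_hasDerivAt ρ h1).hasDerivWithinAt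
    have hbound : ∀ ρ ∈ Icc a R, ‖fderiv ℝ (T t) (x₀ + ρ • ξ) ξ‖ ≤ G := fun ρ hρ => by
      refine (ContinuousLinearMap.le_opNorm _ _).trans ?_
      rw [hξ, mul_one]
      exact hG t ht _ (by rw [hnorm ρ hρ]; exact hρ)
    have h := (convex_Icc a R).norm_image_sub_le_of_norm_hasDerivWithin_le hder hbound hr' hr
    rw [Real.norm_eq_abs, Real.norm_eq_abs] at h
    exact h
  -- the oscillation: Lipschitz in the radius and bounded on `[a,R]`
  have hosc : ∀ t ∈ Icc t₁ t₂, ∀ r ∈ Icc a R, ∀ r' ∈ Icc a R,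
      |sphOsc (T t) x₀ r - sphOsc (T t) x₀ r'| ≤ 2 * G * |r - r'| := by
    intro t ht r hr r' hr'
    have hr0 : 0 < r := ha.trans_le hr.1
    have hr0' : 0 < r' := ha.trans_le hr'.1
    have h1 := abs_sphSup_sub_le_of_forall hr0 hr0' (hcs t ht hr0) (hcs t ht hr0') fun ξ hξ => hray t ht ξ hξ r hr r' hr'
    have h2 := abs_sphInf_sub_le_of_forall hr0 hr0' (hcs t ht hr0) (hcs t ht hr0') fun ξ hξ => hray t ht ξ hξ r hr r' hr'
    unfold sphOsc
    rw [abs_le] at h1 h2 ⊢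
    constructor <;> linarith [h1.1, h1.2, h2.1, h2.2]
  have hoscB : ∀ t ∈ Icc t₁ t₂, ∀ r ∈ Icc a R, 0 ≤ sphOsc (T t) x₀ r ∧ sphOsc (T t) x₀ r ≤ 2 * M := by
    intro t ht r hr
    have hr0 : 0 < r := ha.trans_le hr.1
    have hc := hcs t ht hr0
    obtain ⟨x, hx, hxe⟩ := exists_eq_sphSup hc hr0.le
    obtain ⟨y, hy, hye⟩ := exists_eq_sphInf hc hr0.le
    have hxM := hM t ht x (by rw [mem_sphere_iff_norm.1 hx]; exact hr)
    have hyM := hM t ht y (by rw [mem_sphere_iff_norm.1 hy]; exact hr)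
    refine ⟨sphOsc_nonneg_of_continuousOn hc hr0.le, ?_⟩
    unfold sphOsc
    rw [← hxe, ← hye]
    rw [abs_le] at hxM hyM
    linarith [hxM.2, hyM.1]
  -- the Lipschitz estimate
  refine ⟨Real.toNNReal (R * (2 * G) + 2 * M), fun t ht => LipschitzOnWith.of_dist_le' fun r hr r' hr' => ?_⟩
  rw [Real.dist_eq, Real.dist_eq]
  have hr0 : 0 < r := ha.trans_le hr.1
  have e : netFlux (T t) x₀ r - netFlux (T t) x₀ r' =
      r * (sphOsc (T t) x₀ r - sphOsc (T t) x₀ r') + (r - r') * sphOsc (T t) x₀ r' := by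
    unfold netFlux; ring
  rw [e]
  calc |r * (sphOsc (T t) x₀ r - sphOsc (T t) x₀ r') + (r - r') * sphOsc (T t) x₀ r'|
      ≤ |r * (sphOsc (T t) x₀ r - sphOsc (T t) x₀ r')| + |(r - r') * sphOsc (T t) x₀ r'| := abs_add_le _ _
    _ = r * |sphOsc (T t) x₀ r - sphOsc (T t) x₀ r'| + |r - r'| * sphOsc (T t) x₀ r' := by
        rw [abs_mul, abs_mul, abs_of_pos hr0, abs_of_nonneg (hoscB t ht r' hr').1]
    _ ≤ R * (2 * G * |r - r'|) + |r - r'| * (2 * M) :=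
        add_le_add (mul_le_mul hr.2 (hosc t ht r hr r' hr') (abs_nonneg _) hR0)
          (mul_le_mul_of_nonneg_left (hoscB t ht r' hr').2 (abs_nonneg _))
    _ = (R * (2 * G) + 2 * M) * |r - r'| := by ring

end Summit.NavierStokesRegularity.NavierStokesRegularity.Theorems.PoloidalLiouville.NetFlux

end
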